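import Mathlib.Algebra.Order.Field.GeomSum
import Mathlib.Algebra.Order.Chebyshev
import Mathlib.Topology.MetricSpace.Pseudo.Basic
import Literature.MathematicalPhysics.QuantumFieldTheory.Balaban1983to89.B8Eq191FlatDirichletCoercive
import HarnessLib

/-!
# (n3)-COMB (II) «COMB = STRAIGHT ∘ BLOCK-AXIAL», file II-3: LATTICE SCALE TELESCOPING — the transience price `|ū_{D_j} − ū_{D_k}|² ≤ C·(side D_j)⁻¹·(energy)`
# by BOX POINCARÉ + CAUCHY–SCHWARZ OVER SCALES (d = 3), NO Green's function

Crux `stmt-QuantumFields-19200` `MinimiserStabilityRegPr`, route-R E′ (A′)-on-Σ, package P-A2, row (β); the DISPLAYED route-internal row `hMcomb` («(n3)-comb», SIGNATURE-0,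
★★OWNER RULINGS №19 O4 ∕ №22; OPEN, XL) and its supplier design (II) (PREREAD 6d5726a1 §1 (b), FLATCORE 85b2c314 §3 LEMMA P, MASTER 6efb31c3 §1 row 7 ∕ §5 F-6c).
Seat ym-routeR-w6 g8 (pen «II-3» named by ★routeR-w1 g9 06:35:17Z under ★★OWNER g29 06:31:31Z (a)); `--kind proof --supports stmt-QuantumFields-19200 --as helper`; THEOREMS ONLY;
«(O2) groundwork — not consumed by any displayed row before the freeze lifts»; count-neutral.  YM₃ on T³ is a ladder rung (R3), not Clay; nothing here is progress on the YM mass gap.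

## What is here
§1 THE ABSTRACT HEART (any real normed space `E`, finite index sets of any type) — the three inequalities the dressed file F-6c instantiates with TRANSPORTED block means and the tree's
COVARIANT block Poincaré (✓`Prop7CovariantBlockPoincare.block_poincare_comb`) without touching this file:
* `norm_avg_sub_sq_le` — JENSEN: `‖|D|⁻¹Σ_D u − c‖² ≤ |D|⁻¹Σ_D‖u − c‖²` (any constant `c`; with `c := ū_{D′}`, `D ⊆ D′`, this is the one-scale step);
* `norm_wsum_sub_sq_le` — BLOB PAIRING: for weights `0 ≤ ω ≤ ϱ` of mass `W = Σω`, `‖Σ_D ω•u − W•c‖² ≤ ϱ·W·Σ_D‖u − c‖²`;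
* `sq_sum_le_sum_inv_mul_sum` (weighted Cauchy–Schwarz), `norm_sub_le_sum_Ico` (telescoping), `geom_sum_inv_sqrt_le` + numerals `inv_one_sub_inv_sqrt_le_*` (`c_L := (1 − L^{−1∕2})⁻¹ ≤ 7∕2, 12∕5, 2`
  for `L ≥ 2, 3, 4`);
* ★ `norm_sub_sq_le_of_scale_steps` — THE SCALE CHAIN: if `‖m_i − m_{i+1}‖² ≤ C·(s₀Lⁱ)⁻¹·e_i` for `j ≤ i < k` (the per-scale Poincaré rows, `d = 3` shape), then
  `‖m_j − m_k‖² ≤ C·c_L·(s₀Lʲ)⁻¹·Σ_{i∈[j,k)} (√L)^{−(i−j)}·e_i` — TRANSIENCE = the convergence of `Σ_i L^{−i∕2}`; `k` enters NOWHERE; ★ `norm_sub_sq_le_of_scale_steps_top` (energies bounded by the top one: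
  `≤ C·c_L²·(s₀Lʲ)⁻¹·e`).
§2 THE FLAT REAL CERTIFICATE on honest boxes of `ℤᵈ` (`B = {x : blockMap (n+1) x = y}`, lit ✓`B8Eq191FlatDirichletCoercive.block227_zd` = [Balaban1983RegularityDecay] (2.27) BY NAME):
* `sum_sq_sub_avg_le_grad` — POINCARÉ WITH THE MEAN: `Σ_B (F − F̄_B)² ≤ ((n+1)²∕8)·Σ_μΣ_{x,x+e_μ∈B}(F x − F(x+e_μ))²`;
* `avg_sub_avg_sq_le_step` (d = 3) — ONE SCALE: `B′ ⊆ B` blocks of sides `n′+1`, `n+1 = L(n′+1)` ⇒ `(F̄_{B′} − F̄_B)² ≤ (L²∕8)·(n′+1)⁻¹·grad_B F`;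
* ★★ `avg_sub_avg_sq_le_chain` (d = 3) — nested cornered blocks `D_j ⊆ D_{j+1} ⊆ ⋯` of sides `s₀Lⁱ`: `(F̄_{D_j} − F̄_{D_k})² ≤ (L²∕8)·c_L·(s₀Lʲ)⁻¹·Σ_{i∈[j,k)}(√L)^{−(i−j)}·grad_{D_{i+1}}F
  ≤ (L²∕8)·c_L²·(s₀Lʲ)⁻¹·grad_{D_k}F`;
* ★★ `wsum_sub_avg_sq_le_chain` (d = 3) — BLOB vs TOP MEAN (FLATCORE LEMMA P (P3)): `(Σ_{D_j}ωF − W·F̄_{D_k})² ≤ 2ϱW·((s₀Lʲ)²∕8)·grad_{D_j}F + 2W²·(L²∕8)c_L²·(s₀Lʲ)⁻¹·grad_{D_k}F`.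
DEPENDENCE (RULING №22 ∕ VERDICT (g2)): every constant is a closed numeral in `L` (`L²∕8`, `c_L`); NOTHING depends on `j`, `k`, the number of scales, the torus, `K`, `n`, the member, `ε₀`;
`d = 3` enters exactly in §2's `|B′| = (n′+1)³` against the Poincaré factor `(n+1)²` (in `d = 2` the per-scale factor is `1` and the chain grows like the number of scales; say so).

NOT HERE: comb ∕ tower ∕ transports (F-6c dresses §1 with ✓`block_poincare_comb`), the sum over corners ∕ overlap ∕ Weitzenböck (F-6d), any Green's function.  HONEST: flat lattice
analysis; nothing of `hMcomb` ∕ `hMcomb₂` ∕ (β) ∕ `hD` ∕ hPA2 ∕ hcoS ∕ E′ ∕ EX ∕ the crux is proved or claimed; rung R3 (YM₃ on T³), NOT d = 4, NOT infinite volume, NOT Clay; YM gap NOT proved.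
-/

set_option autoImplicit false

open scoped BigOperators
open Finset

namespace Summit.QuantumFields.YangMills.Theorems.Prop7LatticeScaleTelescoping

open Literature.MathematicalPhysics.QuantumFieldTheory.Balaban1983to89
open Literature.MathematicalPhysics.QuantumLattice (blockMap blockSites mem_blockSites_iff card_blockSites)
open B7Prop1Explicit (e)
open B8Eq191FlatDirichletCoercive (block227_zd)

/-! ## §1 The abstract heart: Jensen, blob pairing, weighted Cauchy–Schwarz, the scale chain -/

section Abstract

variable {ι : Type*} {E : Type*} [NormedAddCommGroup E] [NormedSpace ℝ E]

/-- **JENSEN FOR BLOCK MEANS**: for a non-empty finite `D`, any `u` and any constant `c`, `‖|D|⁻¹·Σ_{x∈D} u x − c‖² ≤ |D|⁻¹·Σ_{x∈D} ‖u x − c‖²` — with `c` the mean over a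
LARGER box this is the one-scale step of Morrey's telescoping. [folklore] [cite: Giaquinta1984, Ch. III §1 p.70; Balaban1983RegularityDecay, (2.27) p.580] -/
theorem norm_avg_sub_sq_le (D : Finset ι) (hD : D.Nonempty) (u : ι → E) (c : E) :
    ‖(D.card : ℝ)⁻¹ • ∑ x ∈ D, u x - c‖ ^ 2 ≤ (D.card : ℝ)⁻¹ * ∑ x ∈ D, ‖u x - c‖ ^ 2 := by
  have hn : (0 : ℝ) < D.card := by exact_mod_cast hD.card_pos
  have hsub : (D.card : ℝ)⁻¹ • ∑ x ∈ D, u x - c = (D.card : ℝ)⁻¹ • ∑ x ∈ D, (u x - c) := by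
    rw [Finset.sum_sub_distrib, Finset.sum_const, ← Nat.cast_smul_eq_nsmul ℝ, smul_sub, smul_smul, inv_mul_cancel₀ hn.ne', one_smul]
  rw [hsub, norm_smul, Real.norm_eq_abs, abs_of_pos (inv_pos.2 hn), mul_pow]
  have h1 : ‖∑ x ∈ D, (u x - c)‖ ≤ ∑ x ∈ D, ‖u x - c‖ := norm_sum_le _ _
  have h2 : (∑ x ∈ D, ‖u x - c‖) ^ 2 ≤ D.card * ∑ x ∈ D, ‖u x - c‖ ^ 2 := sq_sum_le_card_mul_sum_sq
  have h12 : ‖∑ x ∈ D, (u x - c)‖ ^ 2 ≤ D.card * ∑ x ∈ D, ‖u x - c‖ ^ 2 := (pow_le_pow_left₀ (norm_nonneg _) h1 2).trans h2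
  calc ((D.card : ℝ)⁻¹) ^ 2 * ‖∑ x ∈ D, (u x - c)‖ ^ 2 ≤ ((D.card : ℝ)⁻¹) ^ 2 * (D.card * ∑ x ∈ D, ‖u x - c‖ ^ 2) :=
        mul_le_mul_of_nonneg_left h12 (sq_nonneg _)
    _ = (D.card : ℝ)⁻¹ * ∑ x ∈ D, ‖u x - c‖ ^ 2 := by field_simp

/-- **BLOB PAIRING**: for real weights `0 ≤ ω x ≤ ϱ` on `D` with mass `W = Σ_D ω`, `‖Σ_{x∈D} ω x • u x − W • c‖² ≤ ϱ·W·Σ_{x∈D}‖u x − c‖²` (Cauchy–Schwarz with the weights;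
a nonneg chain of mass `W` and density `ϱ` paired against `u` is within `√(ϱW·Σ‖u − c‖²)` of `W·c`). [folklore] [cite: Giaquinta1984, Ch. III §1 p.70] -/
theorem norm_wsum_sub_sq_le (D : Finset ι) (ω : ι → ℝ) {ϱ : ℝ} (hω0 : ∀ x ∈ D, 0 ≤ ω x) (hωϱ : ∀ x ∈ D, ω x ≤ ϱ) (u : ι → E) (c : E) :
    ‖∑ x ∈ D, ω x • u x - (∑ x ∈ D, ω x) • c‖ ^ 2 ≤ ϱ * (∑ x ∈ D, ω x) * ∑ x ∈ D, ‖u x - c‖ ^ 2 := by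
  have hsub : ∑ x ∈ D, ω x • u x - (∑ x ∈ D, ω x) • c = ∑ x ∈ D, ω x • (u x - c) := by
    rw [Finset.sum_smul, ← Finset.sum_sub_distrib]
    exact Finset.sum_congr rfl fun x _ => (smul_sub _ _ _).symm
  rw [hsub]
  have h1 : ‖∑ x ∈ D, ω x • (u x - c)‖ ≤ ∑ x ∈ D, ω x * ‖u x - c‖ := by
    refine (norm_sum_le _ _).trans (Finset.sum_le_sum fun x hx => ?_)
    rw [norm_smul, Real.norm_eq_abs, abs_of_nonneg (hω0 x hx)]
  -- Cauchy–Schwarz with the weights: `(Σ ω a)² ≤ (Σ ω)(Σ ω a²)`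
  have h2 : (∑ x ∈ D, ω x * ‖u x - c‖) ^ 2 ≤ (∑ x ∈ D, ω x) * ∑ x ∈ D, ω x * ‖u x - c‖ ^ 2 :=
    sum_sq_le_sum_mul_sum_of_sq_le_mul D hω0 (fun x hx => mul_nonneg (hω0 x hx) (sq_nonneg _)) (fun x _ => by ring_nf; rfl)
  have h3 : ∑ x ∈ D, ω x * ‖u x - c‖ ^ 2 ≤ ϱ * ∑ x ∈ D, ‖u x - c‖ ^ 2 := by
    rw [Finset.mul_sum]
    exact Finset.sum_le_sum fun x hx => mul_le_mul_of_nonneg_right (hωϱ x hx) (sq_nonneg _)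
  have hW : 0 ≤ ∑ x ∈ D, ω x := Finset.sum_nonneg hω0
  have h0 : 0 ≤ ∑ x ∈ D, ω x * ‖u x - c‖ := Finset.sum_nonneg fun x hx => mul_nonneg (hω0 x hx) (norm_nonneg _)
  calc ‖∑ x ∈ D, ω x • (u x - c)‖ ^ 2 ≤ (∑ x ∈ D, ω x * ‖u x - c‖) ^ 2 := pow_le_pow_left₀ (norm_nonneg _) h1 2
    _ ≤ (∑ x ∈ D, ω x) * ∑ x ∈ D, ω x * ‖u x - c‖ ^ 2 := h2
    _ ≤ (∑ x ∈ D, ω x) * (ϱ * ∑ x ∈ D, ‖u x - c‖ ^ 2) := mul_le_mul_of_nonneg_left h3 hW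
    _ = ϱ * (∑ x ∈ D, ω x) * ∑ x ∈ D, ‖u x - c‖ ^ 2 := by ring

/-- **WEIGHTED CAUCHY–SCHWARZ**: `(Σ_{i∈s} x_i)² ≤ (Σ_{i∈s} θ_i⁻¹)·(Σ_{i∈s} θ_i·x_i²)` for positive weights `θ`. [folklore] [cite: Giaquinta1984, Ch. III §1 p.70] -/
theorem sq_sum_le_sum_inv_mul_sum {κ : Type*} (s : Finset κ) (x θ : κ → ℝ) (hθ : ∀ i ∈ s, 0 < θ i) :
    (∑ i ∈ s, x i) ^ 2 ≤ (∑ i ∈ s, (θ i)⁻¹) * ∑ i ∈ s, θ i * x i ^ 2 :=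
  sum_sq_le_sum_mul_sum_of_sq_le_mul s (fun i hi => (inv_pos.2 (hθ i hi)).le) (fun i hi => mul_nonneg (hθ i hi).le (sq_nonneg _))
    (fun i hi => by rw [← mul_assoc, inv_mul_cancel₀ (hθ i hi).ne', one_mul])

omit [NormedSpace ℝ E] in
/-- **TELESCOPING**: `‖m_j − m_k‖ ≤ Σ_{i∈[j,k)} ‖m_i − m_{i+1}‖`. [folklore] [cite: Giaquinta1984, Ch. III §1 p.70] -/
theorem norm_sub_le_sum_Ico (m : ℕ → E) {j k : ℕ} (hjk : j ≤ k) : ‖m j - m k‖ ≤ ∑ i ∈ Ico j k, ‖m i - m (i + 1)‖ := by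
  have h := dist_le_Ico_sum_dist m hjk
  simpa only [dist_eq_norm] using h

/-- The geometric series of the scale weights: for `1 < L`, `Σ_{i∈[j,k)} ((√L)^{i−j})⁻¹ ≤ (1 − (√L)⁻¹)⁻¹ =: c_L` — independent of `k`. [folklore]
[cite: Giaquinta1984, Ch. III §1 p.70] -/
theorem geom_sum_inv_sqrt_le {L : ℝ} (hL : 1 < L) (j k : ℕ) :
    ∑ i ∈ Ico j k, ((Real.sqrt L) ^ (i - j))⁻¹ ≤ (1 - (Real.sqrt L)⁻¹)⁻¹ := by
  have hs1 : 1 < Real.sqrt L := by rw [← Real.sqrt_one]; exact Real.sqrt_lt_sqrt zero_le_one hL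
  have hs0 : 0 < Real.sqrt L := zero_lt_one.trans hs1
  have hr0 : 0 ≤ (Real.sqrt L)⁻¹ := inv_nonneg.2 hs0.le
  have hr1 : (Real.sqrt L)⁻¹ < 1 := inv_lt_one_of_one_lt₀ hs1
  rcases le_or_gt j k with hjk | hjk
  · rw [Finset.sum_Ico_eq_sum_range]
    have h := geom_sum_Ico_le_of_lt_one (m := 0) (n := k - j) hr0 hr1
    rw [pow_zero, one_div, ← Finset.range_eq_Ico] at h
    refine le_trans (le_of_eq (Finset.sum_congr rfl fun i _ => ?_)) h
    rw [Nat.add_sub_cancel_left, inv_pow]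
  · rw [Finset.Ico_eq_empty (by omega), Finset.sum_empty]
    exact inv_nonneg.2 (by linarith)

/-- Numerals for `c_L = (1 − (√L)⁻¹)⁻¹`: `c_L ≤ 7∕2` for `L ≥ 2`. [folklore] [cite: Giaquinta1984, Ch. III §1 p.70] -/
theorem inv_one_sub_inv_sqrt_le_of_two_le {L : ℝ} (hL : 2 ≤ L) : (1 - (Real.sqrt L)⁻¹)⁻¹ ≤ 7 / 2 := by
  have hs : (7 : ℝ) / 5 < Real.sqrt L := by
    rw [Real.lt_sqrt (by norm_num)]; nlinarith
  have hs0 : 0 < Real.sqrt L := by linarith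
  have hr : (Real.sqrt L)⁻¹ < 5 / 7 := by
    rw [inv_lt_comm₀ hs0 (by norm_num)]; linarith
  rw [inv_le_comm₀ (by linarith) (by norm_num)]
  linarith

/-- `c_L ≤ 12∕5` for `L ≥ 3` (the torus family `T3Family` has `L ≥ 3`). [folklore] [cite: Giaquinta1984, Ch. III §1 p.70] -/
theorem inv_one_sub_inv_sqrt_le_of_three_le {L : ℝ} (hL : 3 ≤ L) : (1 - (Real.sqrt L)⁻¹)⁻¹ ≤ 12 / 5 := by
  have hs : (12 : ℝ) / 7 < Real.sqrt L := by
    rw [Real.lt_sqrt (by norm_num)]; nlinarith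
  have hs0 : 0 < Real.sqrt L := by linarith
  have hr : (Real.sqrt L)⁻¹ < 7 / 12 := by
    rw [inv_lt_comm₀ hs0 (by norm_num)]; linarith
  rw [inv_le_comm₀ (by linarith) (by norm_num)]
  linarith

/-- `c_L ≤ 2` for `L ≥ 4`. [folklore] [cite: Giaquinta1984, Ch. III §1 p.70] -/
theorem inv_one_sub_inv_sqrt_le_of_four_le {L : ℝ} (hL : 4 ≤ L) : (1 - (Real.sqrt L)⁻¹)⁻¹ ≤ 2 := by
  have hs : (2 : ℝ) ≤ Real.sqrt L := by
    rw [Real.le_sqrt (by norm_num) (by linarith)]; nlinarith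
  have hs0 : 0 < Real.sqrt L := by linarith
  have hr : (Real.sqrt L)⁻¹ ≤ 1 / 2 := by
    rw [inv_le_comm₀ hs0 (by norm_num)]; linarith
  rw [inv_le_comm₀ (by linarith) (by norm_num)]
  linarith

omit [NormedSpace ℝ E] in
/-- ★ **THE SCALE CHAIN (d = 3 shape; TRANSIENCE WITHOUT A GREEN'S FUNCTION)**: let `m : ℕ → E` (block means at scales `s_i = s₀Lⁱ`, `1 < L`) satisfy the per-scale Poincaré
rows `‖m_i − m_{i+1}‖² ≤ C·(s₀Lⁱ)⁻¹·e_i` for `j ≤ i < k` (`e_i ≥ 0` the scale-`(i+1)` energies).  Then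
`‖m_j − m_k‖² ≤ C·(1 − (√L)⁻¹)⁻¹·(s₀Lʲ)⁻¹·Σ_{i∈[j,k)} ((√L)^{i−j})⁻¹·e_i` — Cauchy–Schwarz over scales with weights `θ_i = (√L)^{i−j}`; the number of scales `k − j`
enters NOWHERE (in `d = 2` the weights would be `1` and the bound would grow like `k − j`). [folklore] [cite: Giaquinta1984, Ch. III §1 Thm 1.2 p.70; Balaban1984PropagatorsII, (1.9) p.226] -/
theorem norm_sub_sq_le_of_scale_steps (m : ℕ → E) {C s₀ L : ℝ} (hC : 0 ≤ C) (hs₀ : 0 < s₀) (hL : 1 < L) (en : ℕ → ℝ) (hen : ∀ i, 0 ≤ en i)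
    {j k : ℕ} (hjk : j ≤ k) (hstep : ∀ i, j ≤ i → i < k → ‖m i - m (i + 1)‖ ^ 2 ≤ C * (s₀ * L ^ i)⁻¹ * en i) :
    ‖m j - m k‖ ^ 2 ≤ C * (1 - (Real.sqrt L)⁻¹)⁻¹ * (s₀ * L ^ j)⁻¹ * ∑ i ∈ Ico j k, ((Real.sqrt L) ^ (i - j))⁻¹ * en i := by
  have hL0 : 0 < L := zero_lt_one.trans hL
  have hs1 : 1 < Real.sqrt L := by rw [← Real.sqrt_one]; exact Real.sqrt_lt_sqrt zero_le_one hL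
  have hs0 : 0 < Real.sqrt L := zero_lt_one.trans hs1
  have hsq : Real.sqrt L ^ 2 = L := Real.sq_sqrt hL0.le
  -- the weights `θ_i = (√L)^{i−j}`
  set θ : ℕ → ℝ := fun i => Real.sqrt L ^ (i - j) with hθ
  have hθpos : ∀ i, 0 < θ i := fun i => pow_pos hs0 _
  have h1 : ‖m j - m k‖ ^ 2 ≤ (∑ i ∈ Ico j k, ‖m i - m (i + 1)‖) ^ 2 := pow_le_pow_left₀ (norm_nonneg _) (norm_sub_le_sum_Ico m hjk) 2
  have h2 := sq_sum_le_sum_inv_mul_sum (Ico j k) (fun i => ‖m i - m (i + 1)‖) θ (fun i _ => hθpos i)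
  -- the weighted steps: `θ_i·‖Δ_i‖² ≤ C·(s₀Lʲ)⁻¹·θ_i⁻¹·e_i`
  have h3 : ∀ i ∈ Ico j k, θ i * ‖m i - m (i + 1)‖ ^ 2 ≤ C * (s₀ * L ^ j)⁻¹ * ((θ i)⁻¹ * en i) := by
    intro i hi
    rw [Finset.mem_Ico] at hi
    have hij : j ≤ i := hi.1
    have hLi : L ^ i = L ^ j * (θ i) ^ 2 := by
      rw [hθ]; dsimp only
      rw [← pow_mul, mul_comm (i - j) 2, pow_mul, hsq, ← pow_add, Nat.add_sub_cancel' hij]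
    have key : θ i * (C * (s₀ * L ^ i)⁻¹ * en i) = C * (s₀ * L ^ j)⁻¹ * ((θ i)⁻¹ * en i) := by
      rw [hLi]
      field_simp
    calc θ i * ‖m i - m (i + 1)‖ ^ 2 ≤ θ i * (C * (s₀ * L ^ i)⁻¹ * en i) := mul_le_mul_of_nonneg_left (hstep i hij hi.2) (hθpos i).le
      _ = C * (s₀ * L ^ j)⁻¹ * ((θ i)⁻¹ * en i) := key
  have h4 : ∑ i ∈ Ico j k, θ i * ‖m i - m (i + 1)‖ ^ 2 ≤ C * (s₀ * L ^ j)⁻¹ * ∑ i ∈ Ico j k, (θ i)⁻¹ * en i := by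
    rw [Finset.mul_sum]; exact Finset.sum_le_sum h3
  have h5 : ∑ i ∈ Ico j k, (θ i)⁻¹ ≤ (1 - (Real.sqrt L)⁻¹)⁻¹ := geom_sum_inv_sqrt_le hL j k
  have hA0 : 0 ≤ ∑ i ∈ Ico j k, (θ i)⁻¹ := Finset.sum_nonneg fun i _ => (inv_pos.2 (hθpos i)).le
  have hB0 : 0 ≤ C * (s₀ * L ^ j)⁻¹ * ∑ i ∈ Ico j k, (θ i)⁻¹ * en i := by
    have : 0 ≤ ∑ i ∈ Ico j k, (θ i)⁻¹ * en i := Finset.sum_nonneg fun i _ => mul_nonneg (inv_pos.2 (hθpos i)).le (hen i)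
    have : 0 ≤ (s₀ * L ^ j)⁻¹ := inv_nonneg.2 (by positivity)
    positivity
  calc ‖m j - m k‖ ^ 2 ≤ (∑ i ∈ Ico j k, ‖m i - m (i + 1)‖) ^ 2 := h1
    _ ≤ (∑ i ∈ Ico j k, (θ i)⁻¹) * ∑ i ∈ Ico j k, θ i * ‖m i - m (i + 1)‖ ^ 2 := h2
    _ ≤ (∑ i ∈ Ico j k, (θ i)⁻¹) * (C * (s₀ * L ^ j)⁻¹ * ∑ i ∈ Ico j k, (θ i)⁻¹ * en i) := mul_le_mul_of_nonneg_left h4 hA0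
    _ ≤ (1 - (Real.sqrt L)⁻¹)⁻¹ * (C * (s₀ * L ^ j)⁻¹ * ∑ i ∈ Ico j k, (θ i)⁻¹ * en i) := mul_le_mul_of_nonneg_right h5 hB0
    _ = C * (1 - (Real.sqrt L)⁻¹)⁻¹ * (s₀ * L ^ j)⁻¹ * ∑ i ∈ Ico j k, ((Real.sqrt L) ^ (i - j))⁻¹ * en i := by rw [hθ]; ring

omit [NormedSpace ℝ E] in
/-- ★ **THE SCALE CHAIN WITH ENERGIES BOUNDED BY THE TOP ONE**: under the hypotheses of `norm_sub_sq_le_of_scale_steps` and `e_i ≤ e` on `[j, k)`,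
`‖m_j − m_k‖² ≤ C·(1 − (√L)⁻¹)⁻²·(s₀Lʲ)⁻¹·e` — the R-uniform transience price `|ū_{Q_s} − ū_{Q_R}|² ≤ C_tel·s⁻¹·Σ_{Q_R}|∇u|²` of FLATCORE (P2) in abstract form.
[folklore] [cite: Giaquinta1984, Ch. III §1 Thm 1.2 p.70; Balaban1984PropagatorsII, (1.9) p.226] -/
theorem norm_sub_sq_le_of_scale_steps_top (m : ℕ → E) {C s₀ L e₀ : ℝ} (hC : 0 ≤ C) (hs₀ : 0 < s₀) (hL : 1 < L) (he₀ : 0 ≤ e₀)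
    (en : ℕ → ℝ) (hen : ∀ i, 0 ≤ en i) {j k : ℕ} (hjk : j ≤ k)
    (hstep : ∀ i, j ≤ i → i < k → ‖m i - m (i + 1)‖ ^ 2 ≤ C * (s₀ * L ^ i)⁻¹ * en i) (htop : ∀ i, j ≤ i → i < k → en i ≤ e₀) :
    ‖m j - m k‖ ^ 2 ≤ C * (1 - (Real.sqrt L)⁻¹)⁻¹ ^ 2 * (s₀ * L ^ j)⁻¹ * e₀ := by
  have hL0 : 0 < L := zero_lt_one.trans hL
  have hs1 : 1 < Real.sqrt L := by rw [← Real.sqrt_one]; exact Real.sqrt_lt_sqrt zero_le_one hL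
  have hs0 : 0 < Real.sqrt L := zero_lt_one.trans hs1
  have hcL : 0 ≤ (1 - (Real.sqrt L)⁻¹)⁻¹ := inv_nonneg.2 (by rw [sub_nonneg]; exact inv_le_one_of_one_le₀ hs1.le)
  have h := norm_sub_sq_le_of_scale_steps m hC hs₀ hL en hen hjk hstep
  have hsum : ∑ i ∈ Ico j k, ((Real.sqrt L) ^ (i - j))⁻¹ * en i ≤ (1 - (Real.sqrt L)⁻¹)⁻¹ * e₀ :=
    calc ∑ i ∈ Ico j k, ((Real.sqrt L) ^ (i - j))⁻¹ * en i ≤ ∑ i ∈ Ico j k, ((Real.sqrt L) ^ (i - j))⁻¹ * e₀ := by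
          refine Finset.sum_le_sum fun i hi => ?_
          rw [Finset.mem_Ico] at hi
          exact mul_le_mul_of_nonneg_left (htop i hi.1 hi.2) (inv_pos.2 (pow_pos hs0 _)).le
      _ = (∑ i ∈ Ico j k, ((Real.sqrt L) ^ (i - j))⁻¹) * e₀ := by rw [Finset.sum_mul]
      _ ≤ (1 - (Real.sqrt L)⁻¹)⁻¹ * e₀ := mul_le_mul_of_nonneg_right (geom_sum_inv_sqrt_le hL j k) he₀
  have hpre : 0 ≤ C * (1 - (Real.sqrt L)⁻¹)⁻¹ * (s₀ * L ^ j)⁻¹ := by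
    have : 0 ≤ (s₀ * L ^ j)⁻¹ := inv_nonneg.2 (by positivity)
    positivity
  calc ‖m j - m k‖ ^ 2 ≤ C * (1 - (Real.sqrt L)⁻¹)⁻¹ * (s₀ * L ^ j)⁻¹ * ∑ i ∈ Ico j k, ((Real.sqrt L) ^ (i - j))⁻¹ * en i := h
    _ ≤ C * (1 - (Real.sqrt L)⁻¹)⁻¹ * (s₀ * L ^ j)⁻¹ * ((1 - (Real.sqrt L)⁻¹)⁻¹ * e₀) := mul_le_mul_of_nonneg_left hsum hpre
    _ = C * (1 - (Real.sqrt L)⁻¹)⁻¹ ^ 2 * (s₀ * L ^ j)⁻¹ * e₀ := by ring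

end Abstract

/-! ## §2 The flat real certificate on honest boxes of `ℤᵈ` ([Balaban1983RegularityDecay] (2.27) by name) -/

section Flat

variable {d : ℕ}

/-- A box `B = {x : blockMap (n+1) x = y}` of side `n+1` has `(n+1)ᵈ` sites. [cite: Balaban1985Averaging, (2) p.17] -/
theorem card_box (n : ℕ) (y : Fin d → ℤ) (B : Finset (Fin d → ℤ)) (hB : ∀ x, x ∈ B ↔ blockMap (n + 1) x = y) : B.card = (n + 1) ^ d := by
  have hBeq : B = blockSites (n + 1) y := Finset.ext fun x => by rw [hB x, mem_blockSites_iff]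
  rw [hBeq, card_blockSites]

/-- A box is non-empty. [cite: Balaban1985Averaging, (2) p.17] -/
theorem box_nonempty (n : ℕ) (y : Fin d → ℤ) (B : Finset (Fin d → ℤ)) (hB : ∀ x, x ∈ B ↔ blockMap (n + 1) x = y) : B.Nonempty := by
  rw [← Finset.card_pos, card_box n y B hB]; positivity

/-- **POINCARÉ WITH THE MEAN ON A BOX OF `ℤᵈ`**: `Σ_{x∈B} (F x − F̄_B)² ≤ ((n+1)²∕8)·Σ_μ Σ_{x, x+e_μ ∈ B} (F x − F(x+e_μ))²`, `F̄_B = |B|⁻¹Σ_B F` — lit ✓`block227_zd`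
([Balaban1983RegularityDecay] (2.27) with the repaired constant `min{8, a′}`) at `a′ = 8` applied to `F − F̄_B`, whose box sum vanishes.
[cite: Balaban1983RegularityDecay, (2.27) p.580; Balaban1984PropagatorsII, (2.26) p.235] -/
theorem sum_sq_sub_avg_le_grad (n : ℕ) (y : Fin d → ℤ) (B : Finset (Fin d → ℤ)) (hB : ∀ x, x ∈ B ↔ blockMap (n + 1) x = y) (F : (Fin d → ℤ) → ℝ) :
    ∑ x ∈ B, (F x - (B.card : ℝ)⁻¹ * ∑ z ∈ B, F z) ^ 2
      ≤ ((n : ℝ) + 1) ^ 2 / 8 * ∑ μ : Fin d, ∑ x ∈ B.filter (fun x => x + e μ ∈ B), (F x - F (x + e μ)) ^ 2 := by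
  set c : ℝ := (B.card : ℝ)⁻¹ * ∑ z ∈ B, F z with hc
  have hcard : (0 : ℝ) < B.card := by exact_mod_cast (box_nonempty n y B hB).card_pos
  have hsum0 : ∑ x ∈ B, (F x - c) = 0 := by
    rw [Finset.sum_sub_distrib, Finset.sum_const, nsmul_eq_mul, hc, ← mul_assoc, mul_inv_cancel₀ hcard.ne', one_mul, sub_self]
  have h := block227_zd n y B hB 8 (fun x => F x - c)
  rw [min_self, hsum0] at h
  simp only [sub_sub_sub_cancel_right, zero_pow two_ne_zero, mul_zero, add_zero] at h
  have h8 : ∑ x ∈ B, (F x - c) ^ 2 ≤ ((n : ℝ) + 1) ^ 2 / 8 * ∑ μ : Fin d, ∑ x ∈ B.filter (fun x => x + e μ ∈ B), (F x - F (x + e μ)) ^ 2 := by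
    rw [div_mul_eq_mul_div, le_div_iff₀ (by norm_num : (0 : ℝ) < 8), mul_comm]
    exact h
  exact h8

/-- The box gradient energy is monotone under inclusion of boxes (non-negative summands over a larger edge set). [folklore]
[cite: Balaban1983RegularityDecay, (2.27) p.580] -/
theorem grad_mono {B B' : Finset (Fin d → ℤ)} (hsub : B' ⊆ B) (F : (Fin d → ℤ) → ℝ) :
    ∑ μ : Fin d, ∑ x ∈ B'.filter (fun x => x + e μ ∈ B'), (F x - F (x + e μ)) ^ 2
      ≤ ∑ μ : Fin d, ∑ x ∈ B.filter (fun x => x + e μ ∈ B), (F x - F (x + e μ)) ^ 2 := by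
  refine Finset.sum_le_sum fun μ _ => Finset.sum_le_sum_of_subset_of_nonneg ?_ fun x _ _ => sq_nonneg _
  intro x hx
  rw [Finset.mem_filter] at hx ⊢
  exact ⟨hsub hx.1, hsub hx.2⟩

/-- ★ **ONE SCALE (d = 3)**: for boxes `B′ ⊆ B` of sides `n′+1` and `n+1 = L·(n′+1)` in `ℤ³`, `(F̄_{B′} − F̄_B)² ≤ (L²∕8)·(n′+1)⁻¹·grad_B F` — Jensen (`|B′| = (n′+1)³`) and the box Poincaré
(`(n+1)²`): `(n+1)²∕(n′+1)³ = L²∕(n′+1)`.  In `d` dimensions the factor is `L²·(n′+1)^{2−d}`; `d = 3` is where the chain below becomes geometric. [folklore]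
[cite: Giaquinta1984, Ch. III §1 Thm 1.2 p.70; Balaban1983RegularityDecay, (2.27) p.580] -/
theorem avg_sub_avg_sq_le_step {n n' : ℕ} {y y' : Fin 3 → ℤ} {B B' : Finset (Fin 3 → ℤ)} (hB : ∀ x, x ∈ B ↔ blockMap (n + 1) x = y)
    (hB' : ∀ x, x ∈ B' ↔ blockMap (n' + 1) x = y') (hsub : B' ⊆ B) {L : ℝ} (hside : ((n : ℝ) + 1) = L * ((n' : ℝ) + 1)) (F : (Fin 3 → ℤ) → ℝ) :
    ((B'.card : ℝ)⁻¹ * ∑ z ∈ B', F z - (B.card : ℝ)⁻¹ * ∑ z ∈ B, F z) ^ 2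
      ≤ L ^ 2 / 8 * ((n' : ℝ) + 1)⁻¹ * ∑ μ : Fin 3, ∑ x ∈ B.filter (fun x => x + e μ ∈ B), (F x - F (x + e μ)) ^ 2 := by
  set c : ℝ := (B.card : ℝ)⁻¹ * ∑ z ∈ B, F z with hc
  set G : ℝ := ∑ μ : Fin 3, ∑ x ∈ B.filter (fun x => x + e μ ∈ B), (F x - F (x + e μ)) ^ 2 with hG
  have hG0 : 0 ≤ G := Finset.sum_nonneg fun _ _ => Finset.sum_nonneg fun _ _ => sq_nonneg _
  have hne' : B'.Nonempty := box_nonempty n' y' B' hB'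
  have hcard' : (B'.card : ℝ) = ((n' : ℝ) + 1) ^ 3 := by rw [card_box n' y' B' hB']; push_cast; ring
  have hn'0 : (0 : ℝ) < (n' : ℝ) + 1 := by positivity
  -- Jensen (the abstract lemma at `E := ℝ`)
  have hJ := norm_avg_sub_sq_le (E := ℝ) B' hne' F c
  simp only [smul_eq_mul, Real.norm_eq_abs, sq_abs] at hJ
  -- Poincaré on the big box, restricted to the small one
  have hP : ∑ x ∈ B', (F x - c) ^ 2 ≤ ((n : ℝ) + 1) ^ 2 / 8 * G :=
    (Finset.sum_le_sum_of_subset_of_nonneg hsub fun x _ _ => sq_nonneg _).trans (sum_sq_sub_avg_le_grad n y B hB F)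
  calc ((B'.card : ℝ)⁻¹ * ∑ z ∈ B', F z - c) ^ 2 ≤ (B'.card : ℝ)⁻¹ * ∑ x ∈ B', (F x - c) ^ 2 := hJ
    _ ≤ (B'.card : ℝ)⁻¹ * (((n : ℝ) + 1) ^ 2 / 8 * G) := mul_le_mul_of_nonneg_left hP (inv_nonneg.2 (Nat.cast_nonneg _))
    _ = L ^ 2 / 8 * ((n' : ℝ) + 1)⁻¹ * G := by rw [hcard', hside]; field_simp

/-- ★★ **THE FLAT SCALE CHAIN (d = 3)**: nested boxes `D_i = {x : blockMap (n_i+1) x = y_i}` of `ℤ³` with sides `n_i + 1 = s₀·Lⁱ` (`1 < L`, `0 < s₀`) and `D_i ⊆ D_{i+1}`; then for `j ≤ k`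
`(F̄_{D_j} − F̄_{D_k})² ≤ (L²∕8)·(1 − (√L)⁻¹)⁻¹·(s₀Lʲ)⁻¹·Σ_{i∈[j,k)} ((√L)^{i−j})⁻¹·grad_{D_{i+1}}F` — §1's scale chain on the per-scale rows of `avg_sub_avg_sq_le_step`; every constant is a numeral
in `L`; the number of scales enters nowhere (TRANSIENCE of `ℤ³` in the currency of box gradient energies, no Green's function).
[folklore] [cite: Giaquinta1984, Ch. III §1 Thm 1.2 p.70; Balaban1984PropagatorsII, (1.9) p.226; Balaban1983RegularityDecay, (2.27) p.580] -/
theorem avg_sub_avg_sq_le_chain (D : ℕ → Finset (Fin 3 → ℤ)) (nn : ℕ → ℕ) (y : ℕ → Fin 3 → ℤ) (hD : ∀ i x, x ∈ D i ↔ blockMap (nn i + 1) x = y i)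
    {s₀ L : ℝ} (hs₀ : 0 < s₀) (hL : 1 < L) (hside : ∀ i, ((nn i : ℝ) + 1) = s₀ * L ^ i) (hnest : ∀ i, D i ⊆ D (i + 1)) (F : (Fin 3 → ℤ) → ℝ)
    {j k : ℕ} (hjk : j ≤ k) :
    (((D j).card : ℝ)⁻¹ * ∑ z ∈ D j, F z - ((D k).card : ℝ)⁻¹ * ∑ z ∈ D k, F z) ^ 2
      ≤ L ^ 2 / 8 * (1 - (Real.sqrt L)⁻¹)⁻¹ * (s₀ * L ^ j)⁻¹ *
          ∑ i ∈ Ico j k, ((Real.sqrt L) ^ (i - j))⁻¹ * ∑ μ : Fin 3, ∑ x ∈ (D (i + 1)).filter (fun x => x + e μ ∈ D (i + 1)), (F x - F (x + e μ)) ^ 2 := by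
  have hL0 : 0 < L := zero_lt_one.trans hL
  -- the block means as a sequence in `ℝ`
  set m : ℕ → ℝ := fun i => ((D i).card : ℝ)⁻¹ * ∑ z ∈ D i, F z with hm
  set en : ℕ → ℝ := fun i => ∑ μ : Fin 3, ∑ x ∈ (D (i + 1)).filter (fun x => x + e μ ∈ D (i + 1)), (F x - F (x + e μ)) ^ 2 with hen
  have hen0 : ∀ i, 0 ≤ en i := fun i => Finset.sum_nonneg fun _ _ => Finset.sum_nonneg fun _ _ => sq_nonneg _
  have hstep : ∀ i, j ≤ i → i < k → ‖m i - m (i + 1)‖ ^ 2 ≤ L ^ 2 / 8 * (s₀ * L ^ i)⁻¹ * en i := by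
    intro i _ _
    rw [Real.norm_eq_abs, sq_abs]
    have hsd : ((nn (i + 1) : ℝ) + 1) = L * ((nn i : ℝ) + 1) := by rw [hside, hside, pow_succ]; ring
    have h := avg_sub_avg_sq_le_step (hD (i + 1)) (hD i) (hnest i) hsd F
    rw [hside i] at h
    exact h
  have h := norm_sub_sq_le_of_scale_steps (E := ℝ) m (by positivity : (0 : ℝ) ≤ L ^ 2 / 8) hs₀ hL en hen0 hjk hstep
  rw [Real.norm_eq_abs, sq_abs] at h
  exact h

/-- The nesting is monotone: `D_i ⊆ D_{i′}` for `i ≤ i′`. [folklore] [cite: Balaban1985Averaging, (43) p.23] -/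
theorem nest_mono (D : ℕ → Finset (Fin 3 → ℤ)) (hnest : ∀ i, D i ⊆ D (i + 1)) {i i' : ℕ} (h : i ≤ i') : D i ⊆ D i' := by
  induction h with
  | refl => exact le_rfl
  | step _ ih => exact ih.trans (hnest _)

/-- ★★ **THE FLAT SCALE CHAIN, TOP ENERGY (d = 3)**: under the hypotheses of `avg_sub_avg_sq_le_chain`,
`(F̄_{D_j} − F̄_{D_k})² ≤ (L²∕8)·(1 − (√L)⁻¹)⁻²·(s₀Lʲ)⁻¹·grad_{D_k}F` — FLATCORE LEMMA P (P2) `|f̄_{Q_s} − f̄_{Q_R}|² ≤ C_tel·s⁻¹·Σ_{Q_R}|∇f|²` with `C_tel = (L²∕8)·c_L²`, R-uniform.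
[folklore] [cite: Giaquinta1984, Ch. III §1 Thm 1.2 p.70; Balaban1984PropagatorsII, (1.9) p.226; Balaban1983RegularityDecay, (2.27) p.580] -/
theorem avg_sub_avg_sq_le_chain_top (D : ℕ → Finset (Fin 3 → ℤ)) (nn : ℕ → ℕ) (y : ℕ → Fin 3 → ℤ) (hD : ∀ i x, x ∈ D i ↔ blockMap (nn i + 1) x = y i)
    {s₀ L : ℝ} (hs₀ : 0 < s₀) (hL : 1 < L) (hside : ∀ i, ((nn i : ℝ) + 1) = s₀ * L ^ i) (hnest : ∀ i, D i ⊆ D (i + 1)) (F : (Fin 3 → ℤ) → ℝ)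
    {j k : ℕ} (hjk : j ≤ k) :
    (((D j).card : ℝ)⁻¹ * ∑ z ∈ D j, F z - ((D k).card : ℝ)⁻¹ * ∑ z ∈ D k, F z) ^ 2
      ≤ L ^ 2 / 8 * (1 - (Real.sqrt L)⁻¹)⁻¹ ^ 2 * (s₀ * L ^ j)⁻¹ * ∑ μ : Fin 3, ∑ x ∈ (D k).filter (fun x => x + e μ ∈ D k), (F x - F (x + e μ)) ^ 2 := by
  have hL0 : 0 < L := zero_lt_one.trans hL
  set m : ℕ → ℝ := fun i => ((D i).card : ℝ)⁻¹ * ∑ z ∈ D i, F z with hm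
  set en : ℕ → ℝ := fun i => ∑ μ : Fin 3, ∑ x ∈ (D (i + 1)).filter (fun x => x + e μ ∈ D (i + 1)), (F x - F (x + e μ)) ^ 2 with hen
  set etop : ℝ := ∑ μ : Fin 3, ∑ x ∈ (D k).filter (fun x => x + e μ ∈ D k), (F x - F (x + e μ)) ^ 2 with hetop
  have hen0 : ∀ i, 0 ≤ en i := fun i => Finset.sum_nonneg fun _ _ => Finset.sum_nonneg fun _ _ => sq_nonneg _
  have hetop0 : 0 ≤ etop := Finset.sum_nonneg fun _ _ => Finset.sum_nonneg fun _ _ => sq_nonneg _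
  have hstep : ∀ i, j ≤ i → i < k → ‖m i - m (i + 1)‖ ^ 2 ≤ L ^ 2 / 8 * (s₀ * L ^ i)⁻¹ * en i := by
    intro i _ _
    rw [Real.norm_eq_abs, sq_abs]
    have hsd : ((nn (i + 1) : ℝ) + 1) = L * ((nn i : ℝ) + 1) := by rw [hside, hside, pow_succ]; ring
    have h := avg_sub_avg_sq_le_step (hD (i + 1)) (hD i) (hnest i) hsd F
    rw [hside i] at h
    exact h
  have htop : ∀ i, j ≤ i → i < k → en i ≤ etop := fun i _ hik => grad_mono (nest_mono D hnest (Nat.succ_le_of_lt hik)) F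
  have h := norm_sub_sq_le_of_scale_steps_top (E := ℝ) m (by positivity : (0 : ℝ) ≤ L ^ 2 / 8) hs₀ hL hetop0 en hen0 hjk hstep htop
  rw [Real.norm_eq_abs, sq_abs] at h
  exact h

/-- ★★ **BLOB AGAINST THE TOP MEAN (d = 3; FLATCORE LEMMA P (P3))**: under the hypotheses of `avg_sub_avg_sq_le_chain`, for weights `0 ≤ ω ≤ ϱ` on `D_j` of mass `W = Σ_{D_j}ω`,
`(Σ_{D_j} ω·F − W·F̄_{D_k})² ≤ 2·ϱ·W·((s₀Lʲ)²∕8)·grad_{D_j}F + 2·W²·(L²∕8)·(1 − (√L)⁻¹)⁻²·(s₀Lʲ)⁻¹·grad_{D_k}F` — the in-cell term (§1 blob pairing + box Poincaré on `D_j`) plus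
the scale chain; `k − j` enters nowhere. [folklore] [cite: Giaquinta1984, Ch. III §1 Thm 1.2 p.70; Balaban1984PropagatorsII, (1.9) p.226; Balaban1983RegularityDecay, (2.27) p.580] -/
theorem wsum_sub_avg_sq_le_chain (D : ℕ → Finset (Fin 3 → ℤ)) (nn : ℕ → ℕ) (y : ℕ → Fin 3 → ℤ) (hD : ∀ i x, x ∈ D i ↔ blockMap (nn i + 1) x = y i)
    {s₀ L : ℝ} (hs₀ : 0 < s₀) (hL : 1 < L) (hside : ∀ i, ((nn i : ℝ) + 1) = s₀ * L ^ i) (hnest : ∀ i, D i ⊆ D (i + 1)) (F : (Fin 3 → ℤ) → ℝ)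
    {j k : ℕ} (hjk : j ≤ k) (ω : (Fin 3 → ℤ) → ℝ) {ϱ : ℝ} (hω0 : ∀ x ∈ D j, 0 ≤ ω x) (hωϱ : ∀ x ∈ D j, ω x ≤ ϱ) :
    (∑ x ∈ D j, ω x * F x - (∑ x ∈ D j, ω x) * (((D k).card : ℝ)⁻¹ * ∑ z ∈ D k, F z)) ^ 2
      ≤ 2 * (ϱ * (∑ x ∈ D j, ω x) * ((s₀ * L ^ j) ^ 2 / 8 * ∑ μ : Fin 3, ∑ x ∈ (D j).filter (fun x => x + e μ ∈ D j), (F x - F (x + e μ)) ^ 2))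
        + 2 * ((∑ x ∈ D j, ω x) ^ 2 * (L ^ 2 / 8 * (1 - (Real.sqrt L)⁻¹)⁻¹ ^ 2 * (s₀ * L ^ j)⁻¹ *
            ∑ μ : Fin 3, ∑ x ∈ (D k).filter (fun x => x + e μ ∈ D k), (F x - F (x + e μ)) ^ 2)) := by
  set W : ℝ := ∑ x ∈ D j, ω x with hW
  set cj : ℝ := ((D j).card : ℝ)⁻¹ * ∑ z ∈ D j, F z with hcj
  set ck : ℝ := ((D k).card : ℝ)⁻¹ * ∑ z ∈ D k, F z with hck
  have hW0 : 0 ≤ W := Finset.sum_nonneg hω0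
  -- split at the own mean: `Σ ωF − W·ck = (Σ ωF − W·cj) + W·(cj − ck)`
  have hsplit : ∑ x ∈ D j, ω x * F x - W * ck = (∑ x ∈ D j, ω x * F x - W * cj) + W * (cj - ck) := by ring
  -- the in-cell term: blob pairing + Poincaré on `D_j`
  have hblob := norm_wsum_sub_sq_le (E := ℝ) (D j) ω hω0 hωϱ F cj
  simp only [smul_eq_mul, Real.norm_eq_abs, sq_abs] at hblob
  have hPj := sum_sq_sub_avg_le_grad (nn j) (y j) (D j) (hD j) F
  rw [hside j] at hPj
  have hϱ : 0 ≤ ϱ ∨ D j = ∅ := by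
    rcases (D j).eq_empty_or_nonempty with h | ⟨x, hx⟩
    · exact Or.inr h
    · exact Or.inl ((hω0 x hx).trans (hωϱ x hx))
  have hin : (∑ x ∈ D j, ω x * F x - W * cj) ^ 2
      ≤ ϱ * W * ((s₀ * L ^ j) ^ 2 / 8 * ∑ μ : Fin 3, ∑ x ∈ (D j).filter (fun x => x + e μ ∈ D j), (F x - F (x + e μ)) ^ 2) := by
    rcases hϱ with hϱ0 | hempty
    · exact hblob.trans (mul_le_mul_of_nonneg_left hPj (mul_nonneg hϱ0 hW0))
    · have hW' : W = 0 := by rw [hW, hempty, Finset.sum_empty]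
      rw [hempty, hW'] ; simp
  -- the chain term
  have hchain := avg_sub_avg_sq_le_chain_top D nn y hD hs₀ hL hside hnest F hjk
  have hch : (W * (cj - ck)) ^ 2 ≤ W ^ 2 * (L ^ 2 / 8 * (1 - (Real.sqrt L)⁻¹)⁻¹ ^ 2 * (s₀ * L ^ j)⁻¹ *
      ∑ μ : Fin 3, ∑ x ∈ (D k).filter (fun x => x + e μ ∈ D k), (F x - F (x + e μ)) ^ 2) := by
    rw [mul_pow]; exact mul_le_mul_of_nonneg_left hchain (sq_nonneg _)
  have hab : ∀ a b : ℝ, (a + b) ^ 2 ≤ 2 * a ^ 2 + 2 * b ^ 2 := fun a b => by nlinarith [sq_nonneg (a - b)]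
  calc (∑ x ∈ D j, ω x * F x - W * ck) ^ 2 = ((∑ x ∈ D j, ω x * F x - W * cj) + W * (cj - ck)) ^ 2 := by rw [hsplit]
    _ ≤ 2 * (∑ x ∈ D j, ω x * F x - W * cj) ^ 2 + 2 * (W * (cj - ck)) ^ 2 := hab _ _
    _ ≤ _ := by
        apply add_le_add
        · exact mul_le_mul_of_nonneg_left hin (by norm_num)
        · exact mul_le_mul_of_nonneg_left hch (by norm_num)

end Flat

end Summit.QuantumFields.YangMills.Theorems.Prop7LatticeScaleTelescoping
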